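import Summits.QuantumFields.YangMills.Theorems.BalabanLadderUVTorusClassFemto
import HarnessLib

/-!
# Crux `UVSeamRec` (stmt-QuantumFields-20043), stub `stub_ceilings` (E0′): the DEFECT COLLAR — ceilings from a kernel law
# on GOOD exteriors plus multiplicative rarity of the bad ones

Helper file (`--supports stmt-QuantumFields-20043`) of the stub seat `ym-20043-seam-s2` (S-A, `stub_ceilings :
UV → MomentBounds6 SU(2) rF uRec`, slot v4-F).  HONEST FRAMING: a consumption-side theorem for an OPEN hypothesis of a
conditional chain; nothing of Bałaban's E0′ is claimed; not a gap, not Clay.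

WHY.  The landed collar (`DlrCollarTransfer.stub_collar6`, `TorusClass.momentBounds6OnSides_of_fbl6`; engine
`Literature…LatticeGaugeDLRFarFactorProofs.abs_integral_prod_sub_mean_le`) consumes a kernel law that is uniform over ALL
exteriors of the cube around each insertion (`FBL6`: `|γ_Λ(η) A − p| ≤ ε` for every `η`).  For 4D `SU(2)` at weak coupling
that sup-over-exteriors currency is suspect (exteriors carrying a coherent abelian flux `B` through the cube faces, in
the window between the Nielsen–Olesen threshold `2π²/b²` and the current-sheet threshold `≈ (2/b) ln b`, penetrate
classically and shift the centre plaquette by `O(B²) ≫ C/b⁴`; seat note `CEILINGS-KERNEL-ANALYSIS-seam-s2.md`, lead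
ym-spine-20043-p1 g7's kit experiment), while the TEMPERED law (exteriors obeying small-field conditions near the cube)
is the statement a background-field version of Bałaban's analysis would give.  A tempered law alone does not collar: the
bad exteriors must also be RARE, MULTIPLICATIVELY over separated cubes, under the torus state.  This file proves exactly
that consumption form, on a torus of ANY side:

* §1 `integral_prod_sub_mean_eq_integral_prod_collared` — the collar IDENTITY with no kernel hypothesis at all:
  `⟨∏ᵢ (Aᵢ − mᵢ)⟩_{Λ_L,β} = ⟨∏ᵢ (γ_{Λᵢ}Aᵢ − mᵢ)⟩_{Λ_L,β}` for bounded continuous cylinder observables `Aᵢ` and link sets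
  `Λᵢ` in the collar geometry of the tree engine (one torus-DLR step per site, the far factor threaded; the tree engine
  proves this inline under its sup hypothesis — here it is exposed).
* §1 `abs_integral_prod_sub_mean_le_of_defects` — **the defect collar**: if `|γ_{Λᵢ}Aᵢ(η) − p| ≤ ε` only for `η` in a
  measurable set `Goodᵢ`, and the torus state gives the bad events multiplicative rarity
  `∫ ∏_{i∈T} 1_{Goodᵢᶜ}(lift V) dμ ≤ δ^{#T}` for every `T`, then `|⟨∏ᵢ (Aᵢ − ⟨Aᵢ⟩)⟩| ≤ (2ε + 2(C_A + |p|)δ)ⁿ`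
  (expand `∏ (ε' + K·1_{Badᵢ})` over subsets, integrate termwise, binomial theorem).  At `Goodᵢ = univ`, `δ = 0` it is the
  tree engine's `(2ε)ⁿ`.
* sibling file `…CeilingsDefectCollarMoments.lean`: the corollaries in the route's vocabulary —
  `momentBounds6_of_goodLaw_and_rarity` (the registered odd-torus currency `MomentBounds6 G r a` from (a) the
  plane-resolved centre law on good exteriors of the radius-`R+1` cube and (b) multiplicative rarity `(C₂/R⁴)^{#T}` of
  bad cube-exteriors at separated sites on every odd torus) and `momentBounds6OnSides_of_goodLaw_and_rarity` (the class
  currency `MomentBounds6OnSides G r a 𝓣`, p464599; on Track A's even class a chessboard estimate is the intended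
  supplier of (b)).

References: H.-O. Georgii, *Gibbs Measures and Phase Transitions* (2011) Thm. 4.17; E. Seiler, LNP 159 (1982) Ch. 2;
J. Fröhlich, R. Israel, E. H. Lieb, B. Simon, Commun. Math. Phys. 62 (1978) §4 (chessboard estimates, the model for (b));
T. Bałaban, Commun. Math. Phys. 122 (1989) 355–392 (large-field regions are rare: the other model for (b)).
-/

set_option autoImplicit false

noncomputable section

open MeasureTheory Filter Topology Finset
open Literature.Probability.LatticeModels
open Literature.MathematicalPhysics.QuantumFieldTheory (GaugeConfig wilsonMeasure isProbabilityMeasure_wilsonMeasure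
  measurable_torusLift LatticeRep)
open Literature.MathematicalPhysics.QuantumLattice

namespace Summit.QuantumFields.YangMills.Cruxes.UVSeamRec.DefectCollar

/-! ## §1 The collar identity and the defect collar (any dimension, any torus side) -/

section Engine

variable {d N : ℕ} {G : Type*} [Group G] [TopologicalSpace G] [IsTopologicalGroup G]
  [CompactSpace G] [MeasurableSpace G] [BorelSpace G] [SecondCountableTopology G]
  (ρ : G →* Matrix (Fin N) (Fin N) ℂ)

/-- **The collar identity.**  On the torus of side `L`, for bounded continuous cylinder observables `A₁, …, Aₙ`
(supports `Sᵢ`) and link sets `Λᵢ` such that each `Λᵢ ∪ Sᵢ ∪ ∂Λᵢ` injects into the torus and, for `i ≠ j`, the torus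
images of `Sⱼ ∪ ∂Λⱼ` and `Λᵢ` are disjoint, and ANY constants `mᵢ`,
`∫ ∏ᵢ (Aᵢ(lift V) − mᵢ) dμ = ∫ ∏ᵢ ((γ_{Λᵢ}Aᵢ)(lift V) − mᵢ) dμ`: one torus-DLR step per site
(`integral_torusLift_mul_eq_integral_ymSpecification_mul`), the already collared factors and the raw far factors forming
the far factor.  The tree engine `abs_integral_prod_sub_mean_le` proves this inline; no kernel bound is used.
[folklore: Georgii (2011) Thm. 4.17 / (4.18); Seiler LNP 159 Ch. 2] -/
theorem integral_prod_sub_mean_eq_integral_prod_collared (hρ : Continuous ρ) (β : ℝ) {L : ℕ} [NeZero L] {n : ℕ}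
    (Λ S : Fin n → Finset (ZdEdge d))
    (A : Fin n → LGConfig d G → ℝ) (hAc : ∀ i, Continuous (A i)) {CA : ℝ} (hAb : ∀ i U, |A i U| ≤ CA)
    (hAS : ∀ i, IsCylinder (A i) (S i))
    (hinj : ∀ i, Set.InjOn (Torus.proj L)
      ((Λ i ∪ S i ∪ (plaquettesTouching (Λ i)).biUnion plaquetteEdges).image Prod.fst : Set (Site d)))
    (hfar : ∀ i j, i ≠ j → ∀ e ∈ S j ∪ (plaquettesTouching (Λ j)).biUnion plaquetteEdges, ∀ e' ∈ Λ i,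
      torusEdge L e ≠ torusEdge L e')
    (m : Fin n → ℝ) :
    ∫ V, ∏ i, (A i (torusLift L V) - m i) ∂(wilsonMeasure ρ β) =
      ∫ V, ∏ i, ((∫ U, A i U ∂(ymSpecification ρ β (Λ i) (torusLift L V))) - m i) ∂(wilsonMeasure ρ β) := by
  classical
  haveI := isProbabilityMeasure_wilsonMeasure (d := d) (L := L) ρ hρ β
  -- kernel means and collared observables
  set g : Fin n → LGConfig d G → ℝ := fun i η => ∫ U, A i U ∂(ymSpecification ρ β (Λ i) η) with hgdef
  set h : Fin n → LGConfig d G → ℝ := fun i η => g i η - m i with hhdef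
  have hgcyl : ∀ i, IsCylinder (g i) (S i ∪ (plaquettesTouching (Λ i)).biUnion plaquetteEdges) := fun i =>
    dependsOn_integral_ymSpecification ρ hρ β (Λ i) (hAc i).measurable (hAS i)
  have hgc : ∀ i, Continuous (g i) := fun i =>
    continuous_integral_ymSpecification ρ hρ β (Λ i) (hAc i) (hAb i)
  have hgb : ∀ i η, |g i η| ≤ CA := fun i η => abs_integral_ymSpecification_le ρ hρ β (Λ i) (hAb i) η
  have hhb : ∀ i η, |h i η| ≤ CA + |m i| := fun i η =>
    (abs_sub _ _).trans (add_le_add_left (hgb i η) _)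
  have hhcyl : ∀ i, IsCylinder (h i) (S i ∪ (plaquettesTouching (Λ i)).biUnion plaquetteEdges) :=
    fun i U V hUV => by simp only [hhdef, hgcyl i hUV]
  have hhc : ∀ i, Continuous (h i) := fun i => (hgc i).sub continuous_const
  -- far factors do not feel the links over `Λ i`
  have hhfar : ∀ i j, i ≠ j → ∀ W V,
      h j (torusLift L (((Λ i).image (torusEdge L)).piecewise W V)) = h j (torusLift L V) :=
    fun i j hij W V => apply_torusLift_piecewise_eq (hhcyl j) (hfar i j hij) W V
  have hAfar : ∀ i j, i ≠ j → ∀ W V,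
      A j (torusLift L (((Λ i).image (torusEdge L)).piecewise W V)) = A j (torusLift L V) :=
    fun i j hij W V => apply_torusLift_piecewise_eq (hAS j)
      (fun e he => hfar i j hij e (Finset.mem_union_left _ he)) W V
  -- the collar identity, by induction on the set `T` of already collared sites
  have hcollar : ∀ T : Finset (Fin n),
      ∫ V, (∏ i ∈ T, h i (torusLift L V)) * ∏ i ∈ Tᶜ, (A i (torusLift L V) - m i)
          ∂(wilsonMeasure ρ β) =
        ∫ V, ∏ i, (A i (torusLift L V) - m i) ∂(wilsonMeasure ρ β) := by
    intro T
    induction T using Finset.induction_on with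
    | empty => simp
    | @insert i T hiT ih =>
      rw [← ih]
      have hTc : Tᶜ = insert i (insert i T)ᶜ := (Finset.insert_compl_insert hiT).symm
      have hi' : i ∉ (insert i T)ᶜ := fun hh => (Finset.mem_compl.1 hh) (Finset.mem_insert_self i T)
      rw [hTc]
      simp only [Finset.prod_insert hiT, Finset.prod_insert hi']
      -- the far factor of the DLR step at `i`
      set H : GaugeConfig d L G → ℝ := fun V =>
        (∏ j ∈ T, h j (torusLift L V)) * ∏ j ∈ (insert i T)ᶜ, (A j (torusLift L V) - m j) with hHdef
      have hHc : Continuous H :=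
        (continuous_finsetProd T fun j _ => (hhc j).comp (continuous_torusLift L)).mul
          (continuous_finsetProd _ fun j _ =>
            ((hAc j).comp (continuous_torusLift L)).sub continuous_const)
      have hHb : ∀ V, |H V| ≤ (∏ j ∈ T, (CA + |m j|)) * ∏ j ∈ (insert i T)ᶜ, (CA + |m j|) := fun V => by
        simp only [hHdef, abs_mul]
        refine mul_le_mul (abs_prod_le_prod T (f := fun j V => h j (torusLift L V)) (fun j _ V => hhb j _) V)
          (abs_prod_le_prod _ (f := fun j V => A j (torusLift L V) - m j)
            (fun j _ V => (abs_sub _ _).trans (add_le_add_left (hAb j _) _)) V)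
          (abs_nonneg _) ?_
        exact Finset.prod_nonneg fun j _ => (abs_nonneg _).trans (hhb j (torusLift L V))
      have hHpw : ∀ W V, H (((Λ i).image (torusEdge L)).piecewise W V) = H V := by
        intro W V
        simp only [hHdef]
        congr 1
        · exact Finset.prod_congr rfl fun j hj => hhfar i j (fun e => hiT (e ▸ hj)) W V
        · exact Finset.prod_congr rfl fun j hj => by rw [hAfar i j (fun e => hi' (e ▸ hj)) W V]
      have key := integral_torusLift_mul_eq_integral_ymSpecification_mul ρ hρ β (Λ i)
        (F := fun U => A i U - m i) ((hAc i).sub continuous_const) (C := CA + |m i|)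
        (fun U => (abs_sub _ _).trans (add_le_add_left (hAb i U) _)) (S₀ := S i)
        (fun U V hUV => by simp only [hAS i hUV]) (hinj i) hHc.measurable hHb hHpw
      have hkern : ∀ V, ∫ U, (A i U - m i) ∂(ymSpecification ρ β (Λ i) (torusLift L V)) =
          h i (torusLift L V) := by
        intro V
        haveI := isProbabilityMeasure_ymSpecification ρ hρ β (Λ i) (torusLift L V)
        simp only [hhdef, hgdef]
        exact integral_sub_const_of_abs_le (hAc i).measurable (hAb i) (m i)
      simp only [hkern] at key
      calc ∫ V, h i (torusLift L V) * (∏ j ∈ T, h j (torusLift L V)) *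
              ∏ j ∈ (insert i T)ᶜ, (A j (torusLift L V) - m j) ∂(wilsonMeasure ρ β)
          = ∫ V, h i (torusLift L V) * H V ∂(wilsonMeasure ρ β) := by
            refine integral_congr_ae (ae_of_all _ fun V => ?_)
            simp only [hHdef]
            ring
        _ = ∫ V, (A i (torusLift L V) - m i) * H V ∂(wilsonMeasure ρ β) := key.symm
        _ = ∫ V, (∏ j ∈ T, h j (torusLift L V)) * ((A i (torusLift L V) - m i) *
              ∏ j ∈ (insert i T)ᶜ, (A j (torusLift L V) - m j)) ∂(wilsonMeasure ρ β) := by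
            refine integral_congr_ae (ae_of_all _ fun V => ?_)
            simp only [hHdef]
            ring
  -- conclusion: all sites collared
  have hfin := hcollar Finset.univ
  simp only [Finset.compl_univ, Finset.prod_empty, mul_one] at hfin
  rw [← hfin]

/-- **THE DEFECT COLLAR.**  In the geometry of the collar identity, suppose the kernel means are controlled only on GOOD
exteriors — `|γ_{Λᵢ}Aᵢ(η) − p| ≤ ε` for `η ∈ Goodᵢ`, measurable sets — and the torus state gives the bad events
MULTIPLICATIVE RARITY: `∫ ∏_{i∈T} 1_{Goodᵢᶜ}(lift V) dμ ≤ δ^{#T}` for every set `T` of sites.  Then the centred `n`-th moment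
of the `Aᵢ` is at most `(2ε + 2(C_A + |p|)δ)ⁿ`.  Proof: by the collar identity the moment is `∫ ∏ hᵢ(lift V)` with
`hᵢ = γ_{Λᵢ}Aᵢ − ⟨Aᵢ⟩`; `|⟨Aᵢ⟩ − p| ≤ ε + (C_A+|p|)δ` (DLR with trivial far factor, then good/bad split), so
`|hᵢ| ≤ ε' + K·1_{Badᵢ}` with `ε' = 2ε + (C_A+|p|)δ`, `K = C_A + |p|`; expand the product over subsets (`Finset.prod_add`),
integrate termwise with the rarity, resum by the binomial theorem.  The tree engine is the case `Goodᵢ = univ`, `δ = 0`.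
[folklore: Georgii (2011) Thm. 4.17; the rarity input is of chessboard / large-field-suppression type] -/
theorem abs_integral_prod_sub_mean_le_of_defects (hρ : Continuous ρ) (β : ℝ) {L : ℕ} [NeZero L] {n : ℕ}
    (Λ S : Fin n → Finset (ZdEdge d))
    (A : Fin n → LGConfig d G → ℝ) (hAc : ∀ i, Continuous (A i)) {CA : ℝ} (hAb : ∀ i U, |A i U| ≤ CA)
    (hAS : ∀ i, IsCylinder (A i) (S i))
    (hinj : ∀ i, Set.InjOn (Torus.proj L)
      ((Λ i ∪ S i ∪ (plaquettesTouching (Λ i)).biUnion plaquetteEdges).image Prod.fst : Set (Site d)))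
    (hfar : ∀ i j, i ≠ j → ∀ e ∈ S j ∪ (plaquettesTouching (Λ j)).biUnion plaquetteEdges, ∀ e' ∈ Λ i,
      torusEdge L e ≠ torusEdge L e')
    (m : Fin n → ℝ) (hm : ∀ i, m i = ∫ W, A i (torusLift L W) ∂(wilsonMeasure ρ β))
    (Good : Fin n → Set (LGConfig d G)) (hGood : ∀ i, MeasurableSet (Good i))
    {p ε δ : ℝ} (hε : 0 ≤ ε) (hδ : 0 ≤ δ)
    (hker : ∀ i, ∀ η ∈ Good i, |(∫ U, A i U ∂(ymSpecification ρ β (Λ i) η)) - p| ≤ ε)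
    (hrare : ∀ T : Finset (Fin n),
      ∫ V, ∏ i ∈ T, (Good i)ᶜ.indicator (fun _ => (1 : ℝ)) (torusLift L V) ∂(wilsonMeasure ρ β) ≤ δ ^ T.card) :
    |∫ V, ∏ i, (A i (torusLift L V) - m i) ∂(wilsonMeasure ρ β)| ≤ (2 * ε + 2 * (CA + |p|) * δ) ^ n := by
  classical
  haveI := isProbabilityMeasure_wilsonMeasure (d := d) (L := L) ρ hρ β
  rw [integral_prod_sub_mean_eq_integral_prod_collared ρ hρ β Λ S A hAc hAb hAS hinj hfar m]
  -- kernel means, bad indicators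
  set g : Fin n → LGConfig d G → ℝ := fun i η => ∫ U, A i U ∂(ymSpecification ρ β (Λ i) η) with hgdef
  have hgc : ∀ i, Continuous (g i) := fun i =>
    continuous_integral_ymSpecification ρ hρ β (Λ i) (hAc i) (hAb i)
  have hgb : ∀ i η, |g i η| ≤ CA := fun i η => abs_integral_ymSpecification_le ρ hρ β (Λ i) (hAb i) η
  have hgm : ∀ i, Measurable fun V : GaugeConfig d L G => g i (torusLift L V) := fun i =>
    ((hgc i).comp (continuous_torusLift L)).measurable
  set χ : Fin n → LGConfig d G → ℝ := fun i => (Good i)ᶜ.indicator (fun _ => (1 : ℝ)) with hχdef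
  have hχm : ∀ i, Measurable fun V : GaugeConfig d L G => χ i (torusLift L V) := fun i =>
    (measurable_const.indicator (hGood i).compl).comp (measurable_torusLift L)
  have hχ0 : ∀ i η, 0 ≤ χ i η := fun i η => by
    simp only [hχdef]
    exact Set.indicator_nonneg (fun _ _ => zero_le_one) _
  have hχ1 : ∀ i η, χ i η ≤ 1 := fun i η => by
    simp only [hχdef]
    exact Set.indicator_apply_le' (fun _ => le_rfl) (fun _ => zero_le_one)
  have hχb : ∀ i η, |χ i η| ≤ 1 := fun i η => by
    rw [abs_of_nonneg (hχ0 i η)]; exact hχ1 i η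
  -- the degenerate case `n = 0`
  rcases Nat.eq_zero_or_pos n with hn | hn
  · subst hn
    simp
  obtain ⟨i₀⟩ : Nonempty (Fin n) := ⟨⟨0, hn⟩⟩
  have hCA : 0 ≤ CA := (abs_nonneg _).trans (hAb i₀ fun _ => 1)
  set K : ℝ := CA + |p| with hKdef
  have hK : 0 ≤ K := by positivity
  -- the torus mean is the torus mean of the kernel mean (DLR step with trivial far factor)
  have hm' : ∀ i, m i = ∫ V, g i (torusLift L V) ∂(wilsonMeasure ρ β) := fun i => by
    have h1 := integral_torusLift_mul_eq_integral_ymSpecification_mul ρ hρ β (Λ i) (hAc i) (hAb i)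
      (hAS i) (hinj i) (H := fun _ => (1 : ℝ)) measurable_const (D := 1) (fun _ => by simp)
      (fun _ _ => rfl)
    rw [hm i]
    simpa [hgdef] using h1
  -- good/bad split of the kernel law
  have hgp : ∀ i η, |g i η - p| ≤ ε + K * χ i η := by
    intro i η
    by_cases hη : η ∈ Good i
    · have h0 : χ i η = 0 := by
        have : η ∉ (Good i)ᶜ := fun h => h hη
        simp only [hχdef, Set.indicator_of_notMem this]
      rw [h0, mul_zero, add_zero]
      exact hker i η hη
    · have h1 : χ i η = 1 := by
        simp only [hχdef, Set.indicator_of_mem (Set.mem_compl hη)]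
      rw [h1, mul_one]
      calc |g i η - p| ≤ |g i η| + |p| := abs_sub _ _
        _ ≤ CA + |p| := add_le_add_left (hgb i η) _
        _ ≤ ε + K := by rw [hKdef]; linarith
  -- rarity at one site
  have hrare1 : ∀ i, ∫ V, χ i (torusLift L V) ∂(wilsonMeasure ρ β) ≤ δ := fun i => by
    simpa [hχdef] using hrare {i}
  -- the torus means are within `ε + K δ` of `p`
  have hmp : ∀ i, |m i - p| ≤ ε + K * δ := by
    intro i
    have e1 : m i - p = ∫ V, (g i (torusLift L V) - p) ∂(wilsonMeasure ρ β) := by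
      rw [hm' i, integral_sub_const_of_abs_le (hgm i) (fun V => hgb i _) p]
    rw [e1]
    calc |∫ V, (g i (torusLift L V) - p) ∂(wilsonMeasure ρ β)|
        ≤ ∫ V, |g i (torusLift L V) - p| ∂(wilsonMeasure ρ β) := abs_integral_le_integral_abs
      _ ≤ ∫ V, (ε + K * χ i (torusLift L V)) ∂(wilsonMeasure ρ β) := by
          refine integral_mono_of_nonneg (ae_of_all _ fun V => abs_nonneg _) ?_ (ae_of_all _ fun V => hgp i _)
          exact (integrable_const ε).add
            ((integrable_of_abs_le (hχm i) (fun V => hχb i _)).const_mul K)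
      _ = ε + K * ∫ V, χ i (torusLift L V) ∂(wilsonMeasure ρ β) := by
          rw [integral_add (integrable_const ε)
            ((integrable_of_abs_le (hχm i) (fun V => hχb i _)).const_mul K),
            integral_const, integral_const_mul]
          simp
      _ ≤ ε + K * δ := by gcongr; exact hrare1 i
  -- pointwise bound on the collared factors
  set ε' : ℝ := 2 * ε + K * δ with hε'def
  have hε' : 0 ≤ ε' := by positivity
  have hh : ∀ i η, |g i η - m i| ≤ K * χ i η + ε' := by
    intro i η
    have e1 : g i η - m i = (g i η - p) - (m i - p) := by ring
    rw [e1]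
    calc |(g i η - p) - (m i - p)| ≤ |g i η - p| + |m i - p| := abs_sub _ _
      _ ≤ (ε + K * χ i η) + (ε + K * δ) := add_le_add (hgp i η) (hmp i)
      _ = K * χ i η + ε' := by rw [hε'def]; ring
  -- expand the product of the bounds over the set of bad sites
  have hprod : ∀ V, |∏ i, (g i (torusLift L V) - m i)| ≤
      ∑ T ∈ (Finset.univ : Finset (Fin n)).powerset,
        (∏ i ∈ T, K * χ i (torusLift L V)) * ∏ i ∈ Finset.univ \ T, ε' := by
    intro V
    rw [Finset.abs_prod, ← Finset.prod_add]
    exact Finset.prod_le_prod (fun i _ => abs_nonneg _) fun i _ => hh i _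
  -- integrability of the terms
  have hterm_m : ∀ T : Finset (Fin n), Measurable fun V : GaugeConfig d L G =>
      (∏ i ∈ T, K * χ i (torusLift L V)) * ∏ i ∈ Finset.univ \ T, ε' := fun T =>
    (Finset.measurable_prod T fun i _ => (hχm i).const_mul K).mul measurable_const
  have hterm_b : ∀ (T : Finset (Fin n)) (V : GaugeConfig d L G),
      |(∏ i ∈ T, K * χ i (torusLift L V)) * ∏ i ∈ Finset.univ \ T, ε'| ≤
        K ^ T.card * ε' ^ (Finset.univ \ T).card := fun T V => by
    rw [abs_mul]
    refine mul_le_mul (abs_prod_le_pow T (f := fun i V => K * χ i (torusLift L V)) (fun i _ V => ?_) V)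
      (le_of_eq ?_) (abs_nonneg _) (pow_nonneg hK _)
    · rw [abs_mul, abs_of_nonneg hK]
      exact mul_le_of_le_one_right hK (hχb i _)
    · rw [Finset.prod_const, abs_pow, abs_of_nonneg hε']
  have hterm_i : ∀ T : Finset (Fin n), Integrable (fun V : GaugeConfig d L G =>
      (∏ i ∈ T, K * χ i (torusLift L V)) * ∏ i ∈ Finset.univ \ T, ε') (wilsonMeasure ρ β) := fun T =>
    integrable_of_abs_le (hterm_m T) (hterm_b T)
  -- termwise integration against the rarity
  have hint_T : ∀ T : Finset (Fin n),
      ∫ V, (∏ i ∈ T, K * χ i (torusLift L V)) * ∏ i ∈ Finset.univ \ T, ε' ∂(wilsonMeasure ρ β) ≤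
        (K * δ) ^ T.card * ε' ^ (Finset.univ \ T).card := by
    intro T
    have e1 : (fun V : GaugeConfig d L G => (∏ i ∈ T, K * χ i (torusLift L V)) * ∏ i ∈ Finset.univ \ T, ε') =
        fun V => (K ^ T.card * ε' ^ (Finset.univ \ T).card) * ∏ i ∈ T, χ i (torusLift L V) := by
      funext V
      rw [Finset.prod_mul_distrib, Finset.prod_const, Finset.prod_const]
      ring
    have h2 : ∫ V, ∏ i ∈ T, χ i (torusLift L V) ∂(wilsonMeasure ρ β) ≤ δ ^ T.card := by
      simpa only [hχdef] using hrare T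
    rw [e1, integral_const_mul, mul_pow]
    calc K ^ T.card * ε' ^ (Finset.univ \ T).card * ∫ V, ∏ i ∈ T, χ i (torusLift L V) ∂(wilsonMeasure ρ β)
        ≤ K ^ T.card * ε' ^ (Finset.univ \ T).card * δ ^ T.card :=
          mul_le_mul_of_nonneg_left h2 (mul_nonneg (pow_nonneg hK _) (pow_nonneg hε' _))
      _ = K ^ T.card * δ ^ T.card * ε' ^ (Finset.univ \ T).card := by ring
  -- assemble
  calc |∫ V, ∏ i, (g i (torusLift L V) - m i) ∂(wilsonMeasure ρ β)|
      ≤ ∫ V, |∏ i, (g i (torusLift L V) - m i)| ∂(wilsonMeasure ρ β) := abs_integral_le_integral_abs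
    _ ≤ ∫ V, ∑ T ∈ (Finset.univ : Finset (Fin n)).powerset,
          (∏ i ∈ T, K * χ i (torusLift L V)) * ∏ i ∈ Finset.univ \ T, ε' ∂(wilsonMeasure ρ β) :=
        integral_mono_of_nonneg (ae_of_all _ fun V => abs_nonneg _)
          (integrable_finsetSum _ fun T _ => hterm_i T) (ae_of_all _ hprod)
    _ = ∑ T ∈ (Finset.univ : Finset (Fin n)).powerset,
          ∫ V, (∏ i ∈ T, K * χ i (torusLift L V)) * ∏ i ∈ Finset.univ \ T, ε' ∂(wilsonMeasure ρ β) :=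
        integral_finsetSum _ fun T _ => hterm_i T
    _ ≤ ∑ T ∈ (Finset.univ : Finset (Fin n)).powerset, (K * δ) ^ T.card * ε' ^ (Finset.univ \ T).card :=
        Finset.sum_le_sum fun T _ => hint_T T
    _ = ∑ T ∈ (Finset.univ : Finset (Fin n)).powerset,
          (K * δ) ^ T.card * ε' ^ ((Finset.univ : Finset (Fin n)).card - T.card) :=
        Finset.sum_congr rfl fun T hT => by rw [Finset.card_sdiff_of_subset (Finset.mem_powerset.1 hT)]
    _ = (K * δ + ε') ^ (Finset.univ : Finset (Fin n)).card := Finset.sum_pow_mul_eq_add_pow _ _ _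
    _ = (2 * ε + 2 * (CA + |p|) * δ) ^ n := by
        rw [Finset.card_univ, Fintype.card_fin, hε'def, hKdef]; ring_nf

end Engine

end Summit.QuantumFields.YangMills.Cruxes.UVSeamRec.DefectCollar

end
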